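import Mathlib
import HarnessLib
import HarnessLib.Audit
import Summits.Langlands.Statement
import Literature.NumberTheory.Automorphic.CompletedCohomologyHeckeAlgebraGLn
import HarnessLib.Audit.Status.Attr

/-!
Route: EvenIcosahedralCMCorner

# Route EvenIcosahedralCMCorner — even icosahedral rho at the enormous Klein prime p=3 — CM door,
3-adic pro-automorphy at the Artin weight, classicality wall, soluble descent

X (shared target of the even-Artin cards, = item EvenIcosahedralStrongArtin of route
EvenArtinGL4Door): every irreducible EVEN
ρ : Γ_ℚ → GL₂(ℂ) of icosahedral type is automorphic in Tunnell's a.e. sense (a cuspidal π on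
GL₂(𝔸_ℚ) whose Satake parameters are
the arithmetic-Frobenius eigenvalues of ρ at almost every place); X → Langlands is the shared
junction EvenArtinJunction (the rest of
the summit), so this is a SECTOR route (gen 2 of card even-icosahedral-p3-cm-corner; gen 1, route
EvenIcosahedralCM, was retired only
because its assembly stopped at the sector statement). X = X₃ ∧ X₃ᶜ: X₃ = the 3-DISTINGUISHED
sub-sector (ρ unramified at 3 with proj
ρ(Frob₃) of order 2 or 5), which the card's mechanism attacks through the chain CMOrdinaryDoor →
ProAutomorphyAtKleinPrime →
ArtinPointClassicalityCM → UntwistAutomorphy → SolubleDescentMatching; X₃ᶜ (ramified at 3 or proj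
ρ(Frob₃) of order 1 or 3) is the
declared residual sub-sector NonDistinguishedComplement (no engine at p = 3; other cards' business,
e.g. the p = 2 door).
Lean: `∀ ρ : Literature.NumberTheory.GaloisRepresentations.FramedGaloisRep ℚ ℂ 2,
ρ.toGaloisRep.IsIrreducible → Nonempty ((Matrix.ProjGenLinGroup.mk.comp ρ.toMonoidHom).range ≃*
alternatingGroup (Fin 5)) → (∀ (φ : ℚ →+* ℝ) (c : Field.absoluteGaloisGroup ℚ),
Literature.NumberTheory.GaloisRepresentations.IsComplexConjugation φ c →
Matrix.GeneralLinearGroup.det (ρ c) = 1) → ∃ (hcpt :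
Literature.NumberTheory.Automorphic.isCompact_glFiniteIntegralLevel 2 ℚ) (π :
Literature.NumberTheory.Automorphic.CuspidalAutomorphicRepData 2 ℚ hcpt), (∀ᶠ v :
IsDedekindDomain.HeightOneSpectrum (NumberField.RingOfIntegers ℚ) in Filter.cofinite, ∃ α : Multiset
ℂ, π.1.HasSatakeParamAt v α ∧ ρ.IsUnramifiedAt v ∧ ρ.HasFrobCharpolyAt v
(Literature.NumberTheory.Automorphic.satakePolynomial α))`

## Assembly
Pure logic, CHECKED (Sketch.lean / glue.lean, lean check rc 0, `#h21_check_closes` ok, axioms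
propext/Classical.choice/Quot.sound):
`theorem closes : CMOrdinaryDoor → ProAutomorphyAtKleinPrime → ArtinPointClassicalityCM →
UntwistAutomorphy → SolubleDescentMatching →
NonDistinguishedComplement → EvenArtinJunction → Langlands`. An abstract ι : ℚ̄₃ ≃+* ℂ exists
(algebraically closed, char 0,
cardinality 𝔠; proved inline from Mathlib as in EvenArtinGL4Door.closes); the junction reduces the
summit to X; given σ, case on the

Rationale: WHY THIS LINE. Over a soluble Galois CM field M there is no complex conjugation, so τ = χ ⊗ ρ|_M is
a candidate ARTIN POINT of the completed
cohomology of GL₂/M, and p = 3 is the unique Klein prime at which the icosahedral residual image is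
ENORMOUS (ad⁰ of 2·A₅ mod 3 lies
in a 3-block of defect zero: DefectZeroA5), so positive-defect ordinary patching (Calegari–Geraghty;
ACCGHLNSTT2023 = arXiv:1812.09999
Thm 6.1.2 and Rem 6.1.3; KhareThorne2017 = arXiv:1409.7007 Thm 6.30; AllenKhareThorne2021WeightOne =
arXiv:1910.12986 for p = 3 over
CM fields; torsion ordinary local–global compatibility now in print: arXiv:2301.10509,
arXiv:2311.13514 Thm 1.4) can be run at the
maximal ideal of τ̄₃ with every image hypothesis MET rather than circumvented. New in gen 2: the
tree's completed-cohomology vocabulary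
(`BigHeckeGLn.TameLevel.IsPadicallyAutomorphic`, landed 2026-08-15) lets the card's split of the
non-regular-weight barrier be TYPED —
the attackable p-adic half (ProAutomorphyAtKleinPrime: τ₃ is a continuous ℚ̄₃-point of the big Hecke
algebra 𝕋(U^p) of a soluble CM
field, i.e. Hansen–Newton Conj. 1.2.3 at these points, to be proved by Λ-adic ordinary R^ord ↠
𝕋^ord) and the archimedean half
(ArtinPointClassicalityCM: such Artin points are classical), instead of one merged lifting crux; the
door (Ellenberg's level-3
Hilbert–Blumenthal construction moved to a CM base + Shepherd-Barron–Taylor √5–5 switch + AKT over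
CM fields) and the soluble descent
with Galois matching (Langlands–Tunnell-type bookkeeping without Galois representations downstairs)
are the other two cruxes. Imported
areas: p-adic automorphic forms / completed cohomology (Emerton, Calegari–Emerton), modular
representation theory (Brauer defect zero),
arithmetic geometry of Hilbert modular surfaces (rational/CM points), solvable base change
(ArthurClozelAMS120). Versus the negatives index
(one refuted K3 anchor, unrelated) and prior routes: EvenArtinGL4Door works at p = 2 over ℚ on GL₄
by density; BianchiArtinPoints /
RuelleTorsionArtinWeight posit occurrence over imaginary quadratic K with no engine or via torsion
growth; this line supplies an ENGINE
(residual automorphy + lifting at an enormous prime) for occurrence and isolates exactly what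
remains.

RANKED CRUXES. #0 EvenIcosahedralStrongArtin (target) — strong Artin in Tunnell's a.e. sense for
every irreducible even icosahedral ρ : Γ_ℚ → GL₂(ℂ) (shared with route EvenArtinGL4Door,
stmt-Langlands-2903). (why it might fail: False only if Langlands (B) fails for an even icosahedral
ρ/ℚ (refutable by an even ρ with a non-entire twisted L-function, Booker2003); as a goal: no engine
in print — 'we cannot establish the Artin conjecture for a single even A5 representation'
(Calegari2023 §12).) [Calegari2023, Booker2003, BuzzardEtAl2001, KhareWintenberger2009,
DoudMoore2006]
#2 ProAutomorphyAtKleinPrime (crux) — (card C1, the ENGINE, typed in gen 2) M a soluble Galois CM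
field with ζ₃ ∉ M; τ₃ : Γ_M → GL₂(ℚ̄₃) with finite image and projective image A₅, unramified and
3-DISTINGUISHED at every w ∣ 3 (charpoly X² − tX + d with |t² − 4d|₃ = 1), residually ORDINARILY
automorphic: some weight-zero cuspidal π on GL₂(𝔸_M), unramified at w ∣ 3 with a 3-adic unit root
ι⁻¹(√q_w·a) (ι-ordinary), has ι⁻¹(a_w(π)) ≡ tr τ₃(Frob_w) mod 𝔪_ℤ̄₃ for a.e. w. THEN τ₃ is
potentially 3-adically automorphic: over some soluble Galois CM M' ⊇ M (chosen to contain an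
imaginary quadratic field with 3 split and to satisfy ACC+ condition (i)), τ₃|_M' keeps projective
image A₅ and is associated (charpoly of Frobenius = Hecke–Frobenius polynomial at all v outside the
bad set) with a CONTINUOUS ℚ̄₃-valued point of the completed-cohomology Hecke algebra 𝕋(U^p) of
GL₂/M' for some S-good tame level (`TameLevel.IsPadicallyAutomorphic`; Emerton pro-modularity,
Hansen–Newton Conj 1.2.3 at this point). Intended proof: Λ-adic ordinary patching of the ordinary
completed cohomology complex at 𝔪 = 𝔪(τ̄₃ ⊗ χ̄) — KhareThorne2017 Thm 6.30 (big R^ord ↠ 𝕋^ord with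
nilpotent kernel) made unconditional by ACC+ §5–6 / Caraiani–Newton / Hevesi ordinary torsion
local–global compatibility — with enormous image from DefectZeroA5 (p = 3 defect zero),
decomposed-generic primes and the scalar-element condition automatic for projective image A₅ over a
soluble M (Chebotarev in Gal(M/ℚ) × A₅), then specialise the full-support statement at the ARTIN
point (finite-order diagonal characters, 3-distinguished ⇒ a smooth point of the Λ_w-adic ordinary
local deformation space) and push the 𝕋^ord_Λ-point to 𝕋(U^p). No classical point and no density
statement is claimed (Calegari–Mazur Thm 8.1 respected). Convention: the tree's `IsAssociated` uses
ARITHMETIC Frobenius with the Hecke–Frobenius polynomial X² − T_{w,1}X + q_w T_{w,2}; sources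
written with geometric Frobenius give the statement for τ₃^∨, whose hypotheses follow from those of
τ₃ (π ↦ π^∨), so the item is convention-robust. [difficulty: XL] (why it might fail: KT17 Thm 6.30
needs Λ-adic ordinary Galois determinants with LGC at w∣3; in print only finite-level
nilpotent-ideal versions (ACC+ §5; arXiv:2311.13514 Thm 1.4: F ⊃ F₀ with 3 split, cond.(i)) —
uniformity in level/weight and AKT's p=3 image hypotheses for 2·A₅ ⊂ GL₂(F₉) unverified.)
[KhareThorne2017, ACCGHLNSTT2023, AllenKhareThorne2021WeightOne, arXiv:2311.13514, arXiv:2301.10509,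
HansenUniversalEigenvarieties2017, CalegariGeraghty2017, CalegariMazur2008, GeeNewton2020]
#3 ArtinPointClassicalityCM (crux) — (card C5, the WALL, declared) M a CM field, τ : Γ_M → GL₂(ℂ)
with 3-adic avatar τ₃ = ι⁻¹τ (entrywise) of finite image and projective image A₅; if τ₃ is
3-adically automorphic of some S-good tame level (a continuous ℚ̄₃-point of 𝕋(U^p) associated with
τ₃, `TameLevel.IsPadicallyAutomorphic`), then τ is automorphic: a cuspidal π on GL₂(𝔸_M) with Satake
parameters = Frobenius eigenvalues of τ a.e. This is classicality at the Artin (parallel weight one)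
point over a field with a complex place — the residue of NonRegularWeightBarrier once the p-adic
half is split off; kin of RuelleTorsionArtinWeight.ArtinWeightRealisation (imaginary quadratic K,
generic vocabulary) but over CM fields and in the TameLevel vocabulary. Implied by the summit; any
proof closes the even sector through this route's (D,E). (Same Frobenius convention remark as in
ProAutomorphyAtKleinPrime: the class of hypotheses/conclusions is closed under τ ↦ τ^∨, π ↦ π^∨.)
[deps: ProAutomorphyAtKleinPrime] [difficulty: open-problem] (why it might fail: Implied by
Langlands; as a STEP wide open: no Shimura variety or q-expansion over CM, no
overconvergent⇒classical / companion-form criterion at weight one with a complex place (AKT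
1910.12986 §1: 'one does not know how to go from weight 1 to weight 2'); Pan's Sen theory is
ℚ-only.) [AllenKhareThorne2021WeightOne, Calegari2023, Scholze2015,
HansenUniversalEigenvarieties2017, arXiv:2605.03519, arXiv:2209.06366,
Literature.Barriers.Langlands.NonRegularWeightBarrier]
#4 CMOrdinaryDoor (crux) — (card C2 + C4, the DOOR) for every ι : ℚ̄₃ ≃ ℂ and every irreducible even
icosahedral σ : Γ_ℚ → GL₂(ℂ) unramified at 3 with proj σ(Frob₃) of order 2 or 5 (charpoly X² − tX +
d, t² ≠ d, t² ≠ 4d): there are a soluble Galois CM field M with ζ₃ ∉ M, a finite-order character χ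
of Γ_M, τ = χ ⊗ σ|_M (entrywise) and its 3-adic avatar τ₃ (ι(τ₃ g) = τ g) with finite image and
projective image A₅, unramified and 3-distinguished at every w ∣ 3, and a weight-zero cuspidal π on
GL₂(𝔸_M), unramified ι-ordinary at w ∣ 3, congruent to τ₃ mod 𝔪_ℤ̄₃ at a.e. w (VERBATIM the
hypothesis block of ProAutomorphyAtKleinPrime). Intended construction: K = ℚ(√−6)-type imaginary
quadratic base (3 ramified with K₃ ∌ ζ₃ so that ε̄₃ is unramified at w and det τ̄₃ =
ε̄₃·(unramified) is possible with τ̄₃ unramified — the parity obstruction to a cyclotomic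
determinant disappears because K is imaginary and σ even); τ̄₃ ⊗ χ̄ : Γ_M → GL₂(F₉) realised as
A[𝔭₃] for an abelian surface A/M with real multiplication by 𝒪_ℚ(√5), ordinary with good reduction
above 3, over a soluble CM M/K (Ellenberg's twisted level-3 Hilbert modular surface of ℚ(√5), whose
moduli problem has A₆ ≅ PSL₂(F₉) symmetry, transplanted from totally real to CM bases; points by
Moret-Bailly/weak approximation with local conditions at 3 and at the real places of M⁺); A modular
over a soluble CM extension by the √5–5 switch A[√5] ≅ E[5] (Shepherd-Barron–Taylor, X(5) of genus
0) and AKT's theorems for elliptic curves / GL₂(F₅)-representations over CM fields, then 5-adic →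
3-adic bookkeeping inside the compatible system of A; f_w odd at w ∣ 3 so that the Artin point stays
3-distinguished. [difficulty: L] (why it might fail: Ellenberg2005 Prop 1.2/1.3 are totally-real
with ODD ramification at 3,5; here e(w∣3) must be even and the HBAS point CM-valued AND
soluble-Galois/ℚ (a thin global condition Moret-Bailly does not give); AKT 1910.12986 Thm 8.1/9.16
at p=5 need Tate-curve shape at w∣3 and ζ₅ ∉ the projective field.) [Ellenberg2005,
ShepherdBarronTaylor1997, AllenKhareThorne2021WeightOne, doi:10.1073/pnas.2108064118, Taylor2006,
arXiv:1812.09269, ACCGHLNSTT2023]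
#5 SolubleDescentMatching (crux) — (added in gen 1, kept) σ : Γ_ℚ → GL₂(ℂ) irreducible of
icosahedral type; M ⊆ M' number fields with M'/ℚ soluble Galois: if (σ|_M)|_M' is automorphic over
M' (a cuspidal π' with Satake = Frobenius a.e.), then σ is automorphic over ℚ. Existence of descents
layer by layer is Arthur–Clozel (cyclic prime degree; tree facts `ArthurClozel1989_*`); the CONTENT
is matching one descent with σ on every layer without Galois representations for Artin-type forms on
the intermediate (CM / mixed-signature) fields: at inert places the Satake parameter is pinned only
up to a possibly NON-SCALAR root of unity diag(ζ^a, ζ^b); proposed rescues: central-character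
bookkeeping on the two quadratic subfields, parity at the bottom layer (Deligne–Serre),
Ramakrishnan's SL(2) multiplicity one and adjoint rigidity across several imaginary quadratic K (cf.
EvenArtinGL4Door.RealQuadraticDoorDescent and RuelleTorsionArtinWeight's quadratic descent).
Trivially true for odd σ (Khare–Wintenberger), so evenness is not assumed. [difficulty: L] (why it
might fail: Implied by strong Artin; as a step: Langlands–Tunnell pinned the tetrahedral/octahedral
descents with Gelbart–Jacquet Ad(σ) and Tunnell's cubic trick — for A₅ no Ad lift is known, and one
field K leaves π vs π⊗χ_K and non-scalar sign defects at inert p undecided.)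
[LanglandsBaseChange1980, Tunnell1981, ArthurClozelAMS120, Ramakrishnan2000, Rajan1999,
DeligneSerreASENS1974, Calegari2023]
#9 NonDistinguishedComplement (support) — the residual sub-sector this mechanism does not reach:
strong Artin (a.e. sense) for irreducible even icosahedral σ that are ramified at 3 or have proj
σ(Frob₃) of order 1 or 3 (the Artin point is then not 3-distinguished at any place above 3 of any
extension: the weight-one ordinary deformation problem is singular and no door at p = 3 is
proposed). Filed so that `closes` reaches the full sector X; wanted by any p = 2 /
potentially-diagonalisable card. [difficulty: open-problem] [difficulty: open-problem]
[Calegari2023, CalegariGeraghty2017, DoudMoore2006]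
#9 EvenArtinJunction (support) — X → Langlands: the rest of the summit (regular / totally-real–CM
sectors, other n and F, direction (A), and the upgrade of the a.e. Satake matching to `Corresponds`
at every finite place by local–global compatibility + strong multiplicity one). Shared junction of
the even-Artin cards (stmt-Langlands-2908, route EvenArtinGL4Door). [difficulty: open-problem]
[difficulty: open-problem] [BuzzardGeeLMS2014, FontaineMazurGeometric1995]
#9 UntwistAutomorphy (support) — if τ = χ ⊗ σ' entrywise (χ a finite-order character written as a
rank-one representation) and τ is automorphic over M (a.e. Satake = Frobenius), then so is σ' (twist
π by the Hecke character of χ⁻¹: Artin reciprocity for characters is proved in the tree,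
`artinReciprocity_character_holds`; twist API `CuspidalAutomorphicRepData.twist`,
`HasSatakeParamAt.twist`; mirror `exists_twist_quadraticSign_of_reciprocity`). [difficulty:
provable-now] [ArthurClozelAMS120, CasselsFrohlichANT1967,
Literature.NumberTheory.Automorphic.exists_twist_quadraticSign_of_reciprocity]
#9 DefectZeroA5 (support) — (card C3, the enormous-image input of ProAutomorphyAtKleinPrime) every
3-dimensional irreducible representation V of A₅ over a field of characteristic 3 has H¹(A₅, V) =
H²(A₅, V) = 0: such V exist only over fields containing F₉, are absolutely irreducible reductions of
the two degree-3 characters, which lie in 3-blocks of DEFECT ZERO (3 ∤ 60/3), hence are projective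
(Brauer–Nesbitt) with vanishing positive cohomology; consequently ad⁰ of τ̄₃ (projective image A₅ ⊂
PGL₂(F₉)) has H⁰ = H¹ = 0 over 2·A₅ (inflation–restriction through the centre of order 2) and
τ̄₃(Γ_M(ζ₃)) is enormous (ACC+ Def 6.2.28); p = 5 fails (H¹(SL₂(F₅), Sym²) ≠ 0) and p = 2 is
pathological — 3 is the unique enormous Klein prime. [difficulty: provable-now]
[SerreLinearRepresentations1977, CurtisReiner1962, ACCGHLNSTT2023, AllenKhareThorne2021WeightOne]

TWO-LAYER PLAN. Foreseen glued splits (k ≤ 3, depth 1), filed only when a crux moves: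
ProAutomorphyAtKleinPrime ⇐ BigOrdinaryRT (R^ord_𝔪 ↠ 𝕋^ord_𝔪(H̃)
with nilpotent kernel for GL₂ over soluble CM M' at an enormous non-Eisenstein 𝔪, p = 3: KT17 Thm
6.30 made unconditional) →
ArtinPointOnOrdinaryLocus (the 3-distinguished Artin point is an 𝒪-point of R^ord and the induced
𝕋^ord_Λ-point is a continuous point
of 𝕋(U^p)) → E. CMOrdinaryDoor ⇐ CMEllenbergPoint (CM-valued soluble points on the twisted level-3
HMS with local conditions at 3) →
RMSurfaceModularCM (modularity of the RM abelian surface over a soluble CM field via A[√5] ≅ E[5]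
and AKT) → D. SolubleDescentMatching ⇐
LayerDescent (Arthur–Clozel, exists) → MultiFieldMatching (rigidity across ≥ 3 imaginary quadratic
K) → H. The wall F is not split
until someone has a tool; the calibration rung (odd octahedral σ₀ over ℚ(√−2), everything classical)
rides with `--supports` on E.

KILL CRITERIA. (k1) ¬CMOrdinaryDoor for some admissible σ (e.g. the twisted HMS has no CM soluble
points with ordinary good reduction at 3 for every
admissible K) ⇒ only p = 2 doors remain ⇒ close `refuted:CMOrdinaryDoor` (card even-artin-gl4-door
inherits the sector).
(k2) ¬ProAutomorphyAtKleinPrime — e.g. a certified torsion computation showing τ₃'s eigensystem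
ABSENT from H*(X_U(3^r), ℤ/9) of the
relevant arithmetic quotient while present mod 3 — kills the engine and with it the card's
deliverable ⇒ close `refuted:ProAutomorphyAtKleinPrime`.
(k3) SolubleDescentMatching shown to require Galois representations for Artin-type forms on CM
layers ⇒ it merges into the wall: pivot
(drop H, restate the wall over M with descent built in) rather than close. (k4)
ArtinPointClassicalityCM, NonDistinguishedComplement and
EvenArtinJunction are implied by the summit: not refutable without refuting Langlands; strong Artin
for even icosahedral ρ proved
elsewhere (any door) moots the route (`superseded`).

NOT DECOMPOSED YET. The Λ-adic big ordinary R = 𝕋 statement and the continuity/pushforward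
bookkeeping inside E (children above, once E is claimed); the
door's geometry (HBAS/RM moduli notions are not in the tree; the door is stated by its OUTPUT only);
which rescue closes
SolubleDescentMatching; a potentially-diagonalisable or p = 2 treatment of
NonDistinguishedComplement (other cards); local–global
compatibility at ramified places between X and `Corresponds` (inside the shared junction); the
choice of M' (imaginary quadratic subfield
with 3 split, ACC+ condition (i)) is left inside E's ∃.

CHEAPEST FALSIFIER. Two page-checks, cheapest first, neither needing kit: (1)
AllenKhareThorne2021WeightOne (arXiv:1910.12986) — does its p = 3 ordinary
automorphy lifting theorem over CM fields admit residual image 2·A₅ ⊂ GL₂(F₉) (it contains SL₂(F₃) =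
2·A₄) with ζ₃ ∉ M, and does
arXiv:2311.13514 Thm 1.4 / ACC+ §5 give the ordinary torsion LGC at ARBITRARY 3-power level needed
for the Λ-adic limit? A 'no' on
either downgrades E from 'KT 6.30 made unconditional + singular-weight specialisation' to a
conjecture with no engine (route → dormant).
(2) The door's sign bookkeeping for ONE explicit even A₅ field (Doud–Moore's prime-conductor
examples) and K = ℚ(√−6): write
det σ(c_p)-conditions place by place and check that the twisted level-3 HMS descends to ℚ with the
even-ramification condition at 3; a
failure for every admissible K kills the door at p = 3. Not run in this session (searchd/OpenAlex
unavailable; the card's refuter audit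
2026-08-15 already verified the defect-zero lookup C3 on paper).

NUMBERS. l₀(GL₂/M) = [M:ℚ]/2 ≥ 1 (positive defect); |A₅| = 60, 3-part 3, Brauer character degrees
mod 3: 1, 3, 3, 4 (both 3's of defect zero);
p = 5: H¹(SL₂(F₅), Sym²) ≠ 0 (inadequate), p = 2: projective image A₅ ≅ SL₂(F₄) (even/odd merge,
other card); Scholze/NT16 nilpotence
I⁴ = 0 for ρ_𝔪; 3-distinguished ⇔ proj σ(Frob₃) of order 2 or 5 ⇔ t² ∉ {d, 4d} (positive density of
even A₅ fields by Chebotarev);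
Calegari–Mazur Thm 8.1: no Gal(K/ℚ)-compatible classical nearly-ordinary family through ρ|_K
(respected: no classical point claimed).
Items at open: 10 (4 cruxes, 1 target, 4 support, 1 assembly).

DEFINITION REQUESTS. None new at open: `BigHeckeGLn.TameLevel`, `TameLevel.IsPadicallyAutomorphic`
(CompletedCohomologyHeckeAlgebraGLn, landed 2026-08-15)
type the p-adic half; Hilbert–Blumenthal / RM abelian-surface moduli notions (gen-1 request) would
only be needed to split the door and
are not re-filed now.

Novelty: Searches (2026-08-15, this session): `lit frontier Langlands --since 2022` (30 rows; relevant
arXiv:2605.03519 infinitesimal characters of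
completed cohomology of GL_n over CM fields, arXiv:2604.05618 lifts of Hida families); `lit search
--source zbmath` ×8 ("Khare Thorne
potential automorphy Leopoldt" → arXiv:1409.7007; "even Galois representations Fontaine-Mazur" →
Calegari 2011 arXiv:0907.3427;
"nearly ordinary … Calegari Mazur" → arXiv:0708.2451; "universal eigenvarieties Hansen" →
arXiv:1412.1533; "local-global compatibility
torsion ordinary Caraiani Newton" → ACC+ arXiv:1812.09999 and NEW arXiv:2311.13514 (Hevesi,
Q-ordinary torsion LGC, read pp. 1–8 at the
page: Thm 1.1, Thm 1.4 and its conditions); "Serre conjecture F9 Hilbert-Blumenthal" → 0; "abelian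
surfaces potentially modular CM" →
BCGP arXiv:1812.09269 (totally real only); "even icosahedral … Maass" → Henniart Bourbaki 1989,
Booker–Lee–Strömbergsson 2020);
`lit galaxy search --star all` ×3 ("even Artin representation": Weinstein BAMS survey, Bergeron's
book; "ordinary completed cohomology":
0); `lit search --hybrid` / OpenAlex / S2: unavailable or rate-limited this session (logged).
Inherited and relied on: the card's refuter
novelty audit (7 passes, 2026-08-15, OpenAlex/zbMATH/arXiv: nothing but Doud–Moore at the junction)
and gen-1's page reads of
arXiv:0708.2451 §8.2, arXiv:1409.7007 Thm 6.30/§4, arXiv:1812.09999 Thm 6.1.2/Rem 6.1.3/§6.6,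
arXiv:1910.12986 §1/Thm 9.16, math/0107147.
Nearest prior art found: Kh  [refs: 2605.03519, 2604.05618, 1409.7007, 0907.3427, 0708.2451, 1412.1533, 1812.09999, 2311.13514, 1812.09269, 1910.12986, KhareThorne2017, ACCGHLNSTT2023, CalegariMazur2008]

Barriers (technique_class: automorphy-lifting completed-cohomology solvable-descent): - technique_class: automorphy-lifting completed-cohomology solvable-descent
- Literature.Barriers.Langlands.TaylorWilesNumericalCoincidence: APPLIES (l₀ = [M:ℚ]/2 > 0); evaded
as catalogued (Calegari–Geraghty / KT / ACC+ patching of complexes over l₀+1 degrees); the only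
novelty is the weight at which the Λ-adic ordinary output is READ (the Artin point), and Hida theory
makes the count weight-independent.
- Literature.Barriers.Langlands.TaylorWilesNumericalCoincidenceNarrow: APPLIES (n = 2 over CM, τ not
a twist of a base change from M⁺ of anything odd); same evasion; the irregular-weight caveat is
answered by using the Hida-ordinary local condition (dimension [M_w:ℚ₃] at every weight) instead of
a de Rham weight-(0,0) condition.
- Literature.Barriers.Langlands.NonRegularWeightBarrier: MET HEAD-ON and SPLIT (the point of the
card, now typed): the p-adic half — τ₃ occurs in (ordinary) COMPLETED cohomology, not in H*(X, V_λ)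
for a dominant λ, so `cohomologicalInfinityType` is never invoked at the Artin weight — is crux E;
the archimedean half (classicality, the barrier's 'absence of a KNOWN p-adic theory' residue) is
crux F, declared.
- Literature.Barriers.Langlands.ShimuraVarietyRealizationBarrier: not evaded and not needed for D, E
(Betti/completed cohomology of arithmetic quotients of GL₂/M, HBAS moduli only for the residual
door); it is exactly why F is open.
- Literature.Barriers.Langlands.ResiduallyReducibleBarrier: hypotheses MET, not circumvented: at p =
3 the residual

History (route lifecycle, newest last):
- 2026-08-23T09:26:10Z · DORMANT — reconciler: no traction for 6 d (last activity item-evidence-added at 2026-08-17T07:57:36Z); parked, not closed — `ledger route dormant route-Langlands-EvenIcos (operator:999:1710246)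
- 2026-08-29T09:41:43Z · REACTIVATED — reconciler: reactivated — activity statement-checked at 2026-08-29T08:15:59Z after parking at 2026-08-23T09:26:10Z (operator:999:3732371)

sub-problem: Langlands · status: open · opened planner-plancard-Langlands-Langlands-even-ico-c7566e0e-g2-0 2026-08-15T19:06:05Z · rev 4 · ledger route-Langlands-EvenIcosahedralCMCorner
GENERATED by the gate from the ledger (D-0016/17). Provers cite these decls: `theorem foo : Summit.Langlands.Langlands.Theses.EvenIcosahedralCMCorner.<Decl> := …` in Summits/Langlands/Langlands/Theorems/<Name>.lean.
-/

namespace Summit.Langlands.Langlands.Theses.EvenIcosahedralCMCorner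

open scoped BigOperators Topology Manifold Classical MeasureTheory ProbabilityTheory Matrix InnerProductSpace ComplexConjugate ContinuousMap
open Filter Set Function TopologicalSpace MeasureTheory

attribute [summit_statement] _root_.Langlands

/-- item stmt-Langlands-2903 · target · rank 0 · open · by planner
why it might fail: False only if Langlands (B) fails for an even icosahedral ρ/ℚ (refutable in principle by an even ρ with a non-entire twisted L-function, cf. Booker2003); as a goal: no engine in print — not a single even A₅ case of Artin is known (Calegari2023 §12).
sources: Calegari2023, Booker2003, BuzzardEtAl2001, KhareWintenberger2009, DoudMoore2006
[target] strong Artin in Tunnell's a.e. sense for every irreducible even icosahedral ρ : Γ_ℚ →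
GL₂(ℂ): ∃ cuspidal π on GL₂(𝔸_ℚ) with `IsPiOfArtinRep ρ π`. -/
@[route_item "route-Langlands-EvenIcosahedralCMCorner"]
def EvenIcosahedralStrongArtin : Prop :=
  ∀ ρ : Literature.NumberTheory.GaloisRepresentations.FramedGaloisRep ℚ ℂ 2, ρ.toGaloisRep.IsIrreducible → Nonempty ((Matrix.ProjGenLinGroup.mk.comp ρ.toMonoidHom).range ≃* alternatingGroup (Fin 5)) → (∀ (φ : ℚ →+* ℝ) (c : Field.absoluteGaloisGroup ℚ), Literature.NumberTheory.GaloisRepresentations.IsComplexConjugation φ c → Matrix.GeneralLinearGroup.det (ρ c) = 1) → ∃ (hcpt : Literature.NumberTheory.Automorphic.isCompact_glFiniteIntegralLevel 2 ℚ) (π : Literature.NumberTheory.Automorphic.CuspidalAutomorphicRepData 2 ℚ hcpt), (∀ᶠ v : IsDedekindDomain.HeightOneSpectrum (NumberField.RingOfIntegers ℚ) in Filter.cofinite, ∃ α : Multiset ℂ, π.1.HasSatakeParamAt v α ∧ ρ.IsUnramifiedAt v ∧ ρ.HasFrobCharpolyAt v (Literature.NumberTheory.Automorphic.satakePolynomial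 α))

/-- item stmt-Langlands-14074 · crux · rank 2 · open · by planner
why it might fail: Not implied by Langlands (Artin π is non-cohomological; occurrence in H̃• is Hansen Conj 1.2.3); KT17 Thm 6.30 is conditional on Λ-adic ordinary determinants + LGC at w∣3 (Conj 6.28); in print only fixed-weight nilpotent-ideal LGC (ACC+ §5, CN23, Hevesi Thm 1.4 with cond (i)).
sources: KhareThorne2017, arXiv:1409.7007, ACCGHLNSTT2023, arXiv:1812.09999, arXiv:2311.13514, CaraianiNewton2023
[crux] (card C1, the ENGINE, typed in gen 2) M a soluble Galois CM field with ζ₃ ∉ M; τ₃ : Γ_M →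
GL₂(ℚ̄₃) with finite image and projective image A₅, unramified and 3-DISTINGUISHED at every w ∣ 3
(charpoly X² − tX + d with |t² − 4d|₃ = 1), residually ORDINARILY automorphic: some weight-zero
cuspidal π on GL₂(𝔸_M), unramified at w ∣ 3 with a 3-adic unit root ι⁻¹(√q_w·a) (ι-ordinary), has
ι⁻¹(a_w(π)) ≡ tr τ₃(Frob_w) mod 𝔪_ℤ̄₃ for a.e. w. THEN τ₃ is potentially 3-adically automorphic:
over some soluble Galois CM M' ⊇ M (chosen to contain an imaginary quadratic field with 3 split and
to satisfy ACC+ condition (i)), τ₃|_M' keeps projective image A₅ and is associated (charpoly of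
Frobenius = Hecke–Frobenius polynomial at all v outside the bad set) with a CONTINUOUS ℚ̄₃-valued
point of the completed-cohomology Hecke algebra 𝕋(U^p) of GL₂/M' for some S-good tame level
(`TameLevel.IsPadicallyAutomorphic`; Emerton pro-modularity, Hansen–Newton Conj 1.2.3 at this
point). Intended proof: Λ-adic ordinary patching of the ordinary completed cohomology complex at 𝔪 =
𝔪(τ̄₃ ⊗ χ̄) — KhareThorne2017 Thm 6.30 (big R^ord ↠ 𝕋^ord with nilpotent kernel) made unconditional
by ACC+ §5–6 / Caraiani–Newton / -/
@[route_item "route-Langlands-EvenIcosahedralCMCorner", crux]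
def ProAutomorphyAtKleinPrime : Prop :=
  ∀ (ι : PadicAlgCl 3 ≃+* ℂ) (M : Type) [Field M] [NumberField M], NumberField.IsCMField M → IsGalois ℚ M → IsSolvable (M ≃ₐ[ℚ] M) → (∀ z : M, z ^ 2 + z + 1 ≠ 0) → ∀ τ₃ : Literature.NumberTheory.GaloisRepresentations.FramedGaloisRep M (PadicAlgCl 3) 2, Finite τ₃.toMonoidHom.range → (Nonempty ((Matrix.ProjGenLinGroup.mk.comp τ₃.toMonoidHom).range ≃* alternatingGroup (Fin 5)) ∧ (∀ w : IsDedekindDomain.HeightOneSpectrum (NumberField.RingOfIntegers M), (3 : NumberField.RingOfIntegers M) ∈ w.asIdeal → τ₃.IsUnramifiedAt w ∧ ∃ t d : PadicAlgCl 3, τ₃.HasFrobCharpolyAt w (Polynomial.X ^ 2 - Polynomial.C t * Polynomial.X + Polynomial.C d) ∧ ‖t ^ 2 - 4 * d‖ = 1) ∧ ∃ (hM : Literature.NumberTheory.Automorphic.isCompact_glFiniteIntegralLevel 2 M) (π : Literature.NumberTheory.Automorphic.CuspidalAutomorphicRepData 2 M hM), π.1.HasWeightZero ∧ (∀ w : IsDedekindDomain.HeightOneSpectrum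 (NumberField.RingOfIntegers M), (3 : NumberField.RingOfIntegers M) ∈ w.asIdeal → ∃ α : Multiset ℂ, π.1.HasSatakeParamAt w α ∧ ∃ a ∈ α, ‖ι.symm (Real.sqrt w.residueCard * a)‖ = 1) ∧ (∀ᶠ w : IsDedekindDomain.HeightOneSpectrum (NumberField.RingOfIntegers M) in Filter.cofinite, ∃ (α : Multiset ℂ) (t d : PadicAlgCl 3), π.1.HasSatakeParamAt w α ∧ τ₃.IsUnramifiedAt w ∧ τ₃.HasFrobCharpolyAt w (Polynomial.X ^ 2 - Polynomial.C t * Polynomial.X + Polynomial.C d) ∧ ‖t - ι.symm (Real.sqrt w.residueCard * α.sum)‖ < 1)) → ∃ (M' : Type) (_ : Field M') (_ : NumberField M') (_ : Algebra M M'), NumberField.IsCMField M' ∧ IsGalois ℚ M' ∧ IsSolvable (M' ≃ₐ[ℚ] M') ∧ Finite (Literature.NumberTheory.GaloisRepresentations.FramedGaloisRep.restrictField M' τ₃).toMonoidHom.range ∧ Nonempty ((Matrix.ProjGenLinGroup.mk.comp (Literature.NumberTheory.GaloisRepresentations.FramedGaloisRep.restrictField M' τ₃).toMonoidHom).range ≃*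 alternatingGroup (Fin 5)) ∧ ∃ 𝒰 : Literature.NumberTheory.Automorphic.BigHeckeGLn.TameLevel 2 M' 3, 𝒰.IsPadicallyAutomorphic (Literature.NumberTheory.GaloisRepresentations.FramedGaloisRep.restrictField M' τ₃)

/-- item stmt-Langlands-14075 · crux · rank 3 · open · by planner
why it might fail: True if Langlands (B) holds over M; as a STEP it is weight-one classicality over a field with a complex place: no Shimura variety/q-expansion, no overconvergent⇒classical or doubling criterion (AKT 1910.12986 §1: 'one does not know how to go from weight 1 to weight 2'); cf. CM08.
sources: AllenKhareThorne2021WeightOne, arXiv:1910.12986, CalegariMazur2008, Calegari2023, HansenUniversalEigenvarieties2017, Scholze2015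
[crux] (card C5, the WALL, declared) M a CM field, τ : Γ_M → GL₂(ℂ) with 3-adic avatar τ₃ = ι⁻¹τ
(entrywise) of finite image and projective image A₅; if τ₃ is 3-adically automorphic of some S-good
tame level (a continuous ℚ̄₃-point of 𝕋(U^p) associated with τ₃,
`TameLevel.IsPadicallyAutomorphic`), then τ is automorphic: a cuspidal π on GL₂(𝔸_M) with Satake
parameters = Frobenius eigenvalues of τ a.e. This is classicality at the Artin (parallel weight one)
point over a field with a complex place — the residue of NonRegularWeightBarrier once the p-adic
half is split off; kin of RuelleTorsionArtinWeight.ArtinWeightRealisation (imaginary quadratic K,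
generic vocabulary) but over CM fields and in the TameLevel vocabulary. Implied by the summit; any
proof closes the even sector through this route's (D,E). (Same Frobenius convention remark as in
ProAutomorphyAtKleinPrime: the class of hypotheses/conclusions is closed under τ ↦ τ^∨, π ↦ π^∨.)
[deps: ProAutomorphyAtKleinPrime] [difficulty: open-problem] -/
@[route_item "route-Langlands-EvenIcosahedralCMCorner", crux]
def ArtinPointClassicalityCM : Prop :=
  ∀ (ι : PadicAlgCl 3 ≃+* ℂ) (M : Type) [Field M] [NumberField M], NumberField.IsCMField M → ∀ (τ : Literature.NumberTheory.GaloisRepresentations.FramedGaloisRep M ℂ 2) (τ₃ : Literature.NumberTheory.GaloisRepresentations.FramedGaloisRep M (PadicAlgCl 3) 2), (∀ g : Field.absoluteGaloisGroup M, ((τ₃ g : Matrix.GeneralLinearGroup (Fin 2) (PadicAlgCl 3)) : Matrix (Fin 2) (Fin 2) (PadicAlgCl 3)).map ι = ((τ g : Matrix.GeneralLinearGroup (Fin 2) ℂ) : Matrix (Fin 2) (Fin 2) ℂ)) → Finite τ₃.toMonoidHom.range → Nonempty ((Matrix.ProjGenLinGroup.mk.comp τ₃.toMonoidHom).range ≃*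 alternatingGroup (Fin 5)) → (∃ 𝒰 : Literature.NumberTheory.Automorphic.BigHeckeGLn.TameLevel 2 M 3, 𝒰.IsPadicallyAutomorphic τ₃) → ∃ (hM : Literature.NumberTheory.Automorphic.isCompact_glFiniteIntegralLevel 2 M) (π : Literature.NumberTheory.Automorphic.CuspidalAutomorphicRepData 2 M hM), (∀ᶠ w : IsDedekindDomain.HeightOneSpectrum (NumberField.RingOfIntegers M) in Filter.cofinite, ∃ α : Multiset ℂ, π.1.HasSatakeParamAt w α ∧ τ.IsUnramifiedAt w ∧ τ.HasFrobCharpolyAt w (Literature.NumberTheory.Automorphic.satakePolynomial α))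

/-- item stmt-Langlands-14076 · crux · rank 4 · open · by planner
why it might fail: Ellenberg Prop 1.3 is totally real, ODD e at 3,5, inertia 1⊕χ̄₃ at w∣3; here τ̄₃ must be UNRAMIFIED at w∣3 (e even), the twisted-HMS point CM-valued AND soluble-Galois/ℚ (no Moret-Bailly control), and AKT Thm 8.1/9.16 at p=5 need Tate shape at w∣3, ζ₅∉proj field, decomposed-generic ρ̄.
sources: Ellenberg2005, arXiv:math/0107147, ShepherdBarronTaylor1997, AllenKhareThorne2021WeightOne, arXiv:1910.12986, Taylor2006
[crux] (card C2 + C4, the DOOR) for every ι : ℚ̄₃ ≃ ℂ and every irreducible even icosahedral σ : Γ_ℚ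
→ GL₂(ℂ) unramified at 3 with proj σ(Frob₃) of order 2 or 5 (charpoly X² − tX + d, t² ≠ d, t² ≠ 4d):
there are a soluble Galois CM field M with ζ₃ ∉ M, a finite-order character χ of Γ_M, τ = χ ⊗ σ|_M
(entrywise) and its 3-adic avatar τ₃ (ι(τ₃ g) = τ g) with finite image and projective image A₅,
unramified and 3-distinguished at every w ∣ 3, and a weight-zero cuspidal π on GL₂(𝔸_M), unramified
ι-ordinary at w ∣ 3, congruent to τ₃ mod 𝔪_ℤ̄₃ at a.e. w (VERBATIM the hypothesis block of
ProAutomorphyAtKleinPrime). Intended construction: K = ℚ(√−6)-type imaginary quadratic base (3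
ramified with K₃ ∌ ζ₃ so that ε̄₃ is unramified at w and det τ̄₃ = ε̄₃·(unramified) is possible with
τ̄₃ unramified — the parity obstruction to a cyclotomic determinant disappears because K is
imaginary and σ even); τ̄₃ ⊗ χ̄ : Γ_M → GL₂(F₉) realised as A[𝔭₃] for an abelian surface A/M with
real multiplication by 𝒪_ℚ(√5), ordinary with good reduction above 3, over a soluble CM M/K
(Ellenberg's twisted level-3 Hilbert modular surface of ℚ(√5), whose moduli problem has A₆ ≅
PSL₂(F₉) symmetry, transplanted from tota -/
@[route_item "route-Langlands-EvenIcosahedralCMCorner", crux]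
def CMOrdinaryDoor : Prop :=
  ∀ (ι : PadicAlgCl 3 ≃+* ℂ) (σ : Literature.NumberTheory.GaloisRepresentations.FramedGaloisRep ℚ ℂ 2), σ.toGaloisRep.IsIrreducible → Nonempty ((Matrix.ProjGenLinGroup.mk.comp σ.toMonoidHom).range ≃* alternatingGroup (Fin 5)) → (∀ (φ : ℚ →+* ℝ) (c : Field.absoluteGaloisGroup ℚ), Literature.NumberTheory.GaloisRepresentations.IsComplexConjugation φ c → Matrix.GeneralLinearGroup.det (σ c) = 1) → (∀ v : IsDedekindDomain.HeightOneSpectrum (NumberField.RingOfIntegers ℚ), (3 : NumberField.RingOfIntegers ℚ) ∈ v.asIdeal → σ.IsUnramifiedAt v ∧ ∃ t d : ℂ, σ.HasFrobCharpolyAt v (Polynomial.X ^ 2 - Polynomial.C t * Polynomial.X + Polynomial.C d) ∧ t ^ 2 ≠ d ∧ t ^ 2 ≠ 4 * d) → ∃ (M : Type) (_ : Field M) (_ : NumberField M), NumberField.IsCMField M ∧ IsGalois ℚ M ∧ IsSolvable (M ≃ₐ[ℚ] M) ∧ (∀ z : M, z ^ 2 + z + 1 ≠ 0) ∧ ∃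 (χ : Literature.NumberTheory.GaloisRepresentations.FramedGaloisRep M ℂ 1) (τ : Literature.NumberTheory.GaloisRepresentations.FramedGaloisRep M ℂ 2) (τ₃ : Literature.NumberTheory.GaloisRepresentations.FramedGaloisRep M (PadicAlgCl 3) 2), (∀ g : Field.absoluteGaloisGroup M, ((τ g : Matrix.GeneralLinearGroup (Fin 2) ℂ) : Matrix (Fin 2) (Fin 2) ℂ) = ((Matrix.GeneralLinearGroup.det (χ g) : ℂˣ) : ℂ) • ((Literature.NumberTheory.GaloisRepresentations.FramedGaloisRep.restrictField M σ g : Matrix.GeneralLinearGroup (Fin 2) ℂ) : Matrix (Fin 2) (Fin 2) ℂ)) ∧ (∀ g : Field.absoluteGaloisGroup M, ((τ₃ g : Matrix.GeneralLinearGroup (Fin 2) (PadicAlgCl 3)) : Matrix (Fin 2) (Fin 2) (PadicAlgCl 3)).map ι = ((τ g : Matrix.GeneralLinearGroup (Fin 2) ℂ) : Matrix (Fin 2) (Fin 2) ℂ)) ∧ Finite τ₃.toMonoidHom.range ∧ (Nonempty ((Matrix.ProjGenLinGroup.mk.comp τ₃.toMonoidHom).range ≃* alternatingGroup (Fin 5))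 ∧ (∀ w : IsDedekindDomain.HeightOneSpectrum (NumberField.RingOfIntegers M), (3 : NumberField.RingOfIntegers M) ∈ w.asIdeal → τ₃.IsUnramifiedAt w ∧ ∃ t d : PadicAlgCl 3, τ₃.HasFrobCharpolyAt w (Polynomial.X ^ 2 - Polynomial.C t * Polynomial.X + Polynomial.C d) ∧ ‖t ^ 2 - 4 * d‖ = 1) ∧ ∃ (hM : Literature.NumberTheory.Automorphic.isCompact_glFiniteIntegralLevel 2 M) (π : Literature.NumberTheory.Automorphic.CuspidalAutomorphicRepData 2 M hM), π.1.HasWeightZero ∧ (∀ w : IsDedekindDomain.HeightOneSpectrum (NumberField.RingOfIntegers M), (3 : NumberField.RingOfIntegers M) ∈ w.asIdeal → ∃ α : Multiset ℂ, π.1.HasSatakeParamAt w α ∧ ∃ a ∈ α, ‖ι.symm (Real.sqrt w.residueCard * a)‖ = 1) ∧ (∀ᶠ w : IsDedekindDomain.HeightOneSpectrum (NumberField.RingOfIntegers M) in Filter.cofinite, ∃ (α : Multiset ℂ) (t d : PadicAlgCl 3), π.1.HasSatakeParamAt w α ∧ τ₃.IsUnramifiedAt w ∧ τ₃.HasFrobCharpolyAt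 w (Polynomial.X ^ 2 - Polynomial.C t * Polynomial.X + Polynomial.C d) ∧ ‖t - ι.symm (Real.sqrt w.residueCard * α.sum)‖ < 1))

/-- item stmt-Langlands-14077 · crux · rank 5 · open · by planner
why it might fail: Implied by strong Artin; as a STEP, cyclic descent (Arthur–Clozel) gives π only up to Gal-twists: at p inert in an imaginary quadratic layer the Satake pair is ±(α,β) prime by prime; Ad(π), central characters are sign-blind (Ramakrishnan 4.1.2); Tunnell's cure needs non-solvable quintic base change.
sources: LanglandsBaseChange1980, Tunnell1981, ArthurClozelAMS120, Ramakrishnan2000, paper:galaxy-pdf-4279542020, Rajan1999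
[crux] (added in gen 1, kept) σ : Γ_ℚ → GL₂(ℂ) irreducible of icosahedral type; M ⊆ M' number fields
with M'/ℚ soluble Galois: if (σ|_M)|_M' is automorphic over M' (a cuspidal π' with Satake =
Frobenius a.e.), then σ is automorphic over ℚ. Existence of descents layer by layer is Arthur–Clozel
(cyclic prime degree; tree facts `ArthurClozel1989_*`); the CONTENT is matching one descent with σ
on every layer without Galois representations for Artin-type forms on the intermediate (CM /
mixed-signature) fields: at inert places the Satake parameter is pinned only up to a possibly
NON-SCALAR root of unity diag(ζ^a, ζ^b); proposed rescues: central-character bookkeeping on the two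
quadratic subfields, parity at the bottom layer (Deligne–Serre), Ramakrishnan's SL(2) multiplicity
one and adjoint rigidity across several imaginary quadratic K (cf.
EvenArtinGL4Door.RealQuadraticDoorDescent and RuelleTorsionArtinWeight's quadratic descent).
Trivially true for odd σ (Khare–Wintenberger), so evenness is not assumed. [difficulty: L] -/
@[route_item "route-Langlands-EvenIcosahedralCMCorner", crux]
def SolubleDescentMatching : Prop :=
  ∀ σ : Literature.NumberTheory.GaloisRepresentations.FramedGaloisRep ℚ ℂ 2, σ.toGaloisRep.IsIrreducible → Nonempty ((Matrix.ProjGenLinGroup.mk.comp σ.toMonoidHom).range ≃* alternatingGroup (Fin 5)) → ∀ (M : Type) [Field M] [NumberField M] (M' : Type) [Field M'] [NumberField M'] [Algebra M M'], IsGalois ℚ M' → IsSolvable (M' ≃ₐ[ℚ] M') → (∃ (hM' : Literature.NumberTheory.Automorphic.isCompact_glFiniteIntegralLevel 2 M') (π' : Literature.NumberTheory.Automorphic.CuspidalAutomorphicRepData 2 M' hM'), ∀ᶠ w : IsDedekindDomain.HeightOneSpectrum (NumberField.RingOfIntegers M') in Filter.cofinite, ∃ α : Multiset ℂ, π'.1.HasSatakeParamAt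 w α ∧ (Literature.NumberTheory.GaloisRepresentations.FramedGaloisRep.restrictField M' (Literature.NumberTheory.GaloisRepresentations.FramedGaloisRep.restrictField M σ)).IsUnramifiedAt w ∧ (Literature.NumberTheory.GaloisRepresentations.FramedGaloisRep.restrictField M' (Literature.NumberTheory.GaloisRepresentations.FramedGaloisRep.restrictField M σ)).HasFrobCharpolyAt w (Literature.NumberTheory.Automorphic.satakePolynomial α)) → ∃ (hcpt : Literature.NumberTheory.Automorphic.isCompact_glFiniteIntegralLevel 2 ℚ) (π : Literature.NumberTheory.Automorphic.CuspidalAutomorphicRepData 2 ℚ hcpt), ∀ᶠ v : IsDedekindDomain.HeightOneSpectrum (NumberField.RingOfIntegers ℚ) in Filter.cofinite, ∃ α : Multiset ℂ, π.1.HasSatakeParamAt v α ∧ σ.IsUnramifiedAt v ∧ σ.HasFrobCharpolyAt v (Literature.NumberTheory.Automorphic.satakePolynomial α)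

/-- item stmt-Langlands-13565 · support · rank 9 · open · by planner
sources: BuzzardGeeLMS2014, FontaineMazurGeometric1995
[support] X → Langlands with X referenced BY NAME (this route's target decl
EvenIcosahedralStrongArtin, = stmt-Langlands-2903): the rest of the summit (regular /
totally-real–CM sectors, other n and F, direction (A), upgrade of a.e. Satake matching to
`Corresponds` by local–global compatibility + strong multiplicity one). Same content as the shared
junction EvenArtinJunction (stmt-Langlands-2908), filed route-owned so that the deciding theorem's
hypotheses are all items of this route. [difficulty: open-problem] -/
@[route_item "route-Langlands-EvenIcosahedralCMCorner", crux]
def SectorJunction : Prop :=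
  EvenIcosahedralStrongArtin → _root_.Langlands

/-- item stmt-Langlands-14078 · support · rank 9 · open · by planner
sources: Calegari2023, CalegariGeraghty2017, DoudMoore2006
[support] the residual sub-sector this mechanism does not reach: strong Artin (a.e. sense) for
irreducible even icosahedral σ that are ramified at 3 or have proj σ(Frob₃) of order 1 or 3 (the
Artin point is then not 3-distinguished at any place above 3 of any extension: the weight-one
ordinary deformation problem is singular and no door at p = 3 is proposed). Filed so that `closes`
reaches the full sector X; wanted by any p = 2 / potentially-diagonalisable card. [difficulty:
open-problem] [difficulty: open-problem] -/
@[route_item "route-Langlands-EvenIcosahedralCMCorner", crux]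
def NonDistinguishedComplement : Prop :=
  ∀ σ : Literature.NumberTheory.GaloisRepresentations.FramedGaloisRep ℚ ℂ 2, σ.toGaloisRep.IsIrreducible → Nonempty ((Matrix.ProjGenLinGroup.mk.comp σ.toMonoidHom).range ≃* alternatingGroup (Fin 5)) → (∀ (φ : ℚ →+* ℝ) (c : Field.absoluteGaloisGroup ℚ), Literature.NumberTheory.GaloisRepresentations.IsComplexConjugation φ c → Matrix.GeneralLinearGroup.det (σ c) = 1) → ¬ (∀ v : IsDedekindDomain.HeightOneSpectrum (NumberField.RingOfIntegers ℚ), (3 : NumberField.RingOfIntegers ℚ) ∈ v.asIdeal → σ.IsUnramifiedAt v ∧ ∃ t d : ℂ, σ.HasFrobCharpolyAt v (Polynomial.X ^ 2 - Polynomial.C t * Polynomial.X + Polynomial.C d) ∧ t ^ 2 ≠ d ∧ t ^ 2 ≠ 4 * d) → ∃ (hcpt : Literature.NumberTheory.Automorphic.isCompact_glFiniteIntegralLevel 2 ℚ) (π : Literature.NumberTheory.Automorphic.CuspidalAutomorphicRepData 2 ℚ hcpt), (∀ᶠ v : IsDedekindDomain.HeightOneSpectrum (NumberField.RingOfIntegers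 ℚ) in Filter.cofinite, ∃ α : Multiset ℂ, π.1.HasSatakeParamAt v α ∧ σ.IsUnramifiedAt v ∧ σ.HasFrobCharpolyAt v (Literature.NumberTheory.Automorphic.satakePolynomial α))

/-- item stmt-Langlands-14079 · support · rank 9 · closed · proved by Summit.Langlands.Langlands.Theorems.EvenIcosahedralCMCornerUntwistAutomorphy.untwistAutomorphy_proof (prover) · by planner
sources: ArthurClozelAMS120, CasselsFrohlichANT1967, Literature.NumberTheory.Automorphic.exists_twist_quadraticSign_of_reciprocity
[support] if τ = χ ⊗ σ' entrywise (χ a finite-order character written as a rank-one representation)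
and τ is automorphic over M (a.e. Satake = Frobenius), then so is σ' (twist π by the Hecke character
of χ⁻¹: Artin reciprocity for characters is proved in the tree, `artinReciprocity_character_holds`;
twist API `CuspidalAutomorphicRepData.twist`, `HasSatakeParamAt.twist`; mirror
`exists_twist_quadraticSign_of_reciprocity`). [difficulty: provable-now] -/
@[route_item "route-Langlands-EvenIcosahedralCMCorner", crux]
def UntwistAutomorphy : Prop :=
  ∀ (M : Type) [Field M] [NumberField M] (σ' τ : Literature.NumberTheory.GaloisRepresentations.FramedGaloisRep M ℂ 2) (χ : Literature.NumberTheory.GaloisRepresentations.FramedGaloisRep M ℂ 1), (∀ g : Field.absoluteGaloisGroup M, ((τ g : Matrix.GeneralLinearGroup (Fin 2) ℂ) : Matrix (Fin 2) (Fin 2) ℂ) = ((Matrix.GeneralLinearGroup.det (χ g) : ℂˣ) : ℂ) • ((σ' g : Matrix.GeneralLinearGroup (Fin 2) ℂ) : Matrix (Fin 2) (Fin 2) ℂ)) → (∃ (hM : Literature.NumberTheory.Automorphic.isCompact_glFiniteIntegralLevel 2 M) (π : Literature.NumberTheory.Automorphic.CuspidalAutomorphicRepData 2 M hM), ∀ᶠ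 w : IsDedekindDomain.HeightOneSpectrum (NumberField.RingOfIntegers M) in Filter.cofinite, ∃ α : Multiset ℂ, π.1.HasSatakeParamAt w α ∧ τ.IsUnramifiedAt w ∧ τ.HasFrobCharpolyAt w (Literature.NumberTheory.Automorphic.satakePolynomial α)) → ∃ (hM : Literature.NumberTheory.Automorphic.isCompact_glFiniteIntegralLevel 2 M) (π : Literature.NumberTheory.Automorphic.CuspidalAutomorphicRepData 2 M hM), ∀ᶠ w : IsDedekindDomain.HeightOneSpectrum (NumberField.RingOfIntegers M) in Filter.cofinite, ∃ α : Multiset ℂ, π.1.HasSatakeParamAt w α ∧ σ'.IsUnramifiedAt w ∧ σ'.HasFrobCharpolyAt w (Literature.NumberTheory.Automorphic.satakePolynomial α)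

-- `UntwistAutomorphy` holds: proved by `Summit.Langlands.Langlands.Theorems.EvenIcosahedralCMCornerUntwistAutomorphy.untwistAutomorphy_proof` (its module imports this route file, so no `_holds` link can be stated here).

/-- item stmt-Langlands-14080 · support · rank 9 · closed · proved by Summit.Langlands.Langlands.Theorems.EvenIcosahedralCMCornerDefectZeroA5.defectZeroA5 (prover) · by planner
sources: SerreLinearRepresentations1977, CurtisReiner1962, ACCGHLNSTT2023, AllenKhareThorne2021WeightOne
[support] (card C3, the enormous-image input of ProAutomorphyAtKleinPrime) every 3-dimensional
irreducible representation V of A₅ over a field of characteristic 3 has H¹(A₅, V) = H²(A₅, V) = 0: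
such V exist only over fields containing F₉, are absolutely irreducible reductions of the two
degree-3 characters, which lie in 3-blocks of DEFECT ZERO (3 ∤ 60/3), hence are projective
(Brauer–Nesbitt) with vanishing positive cohomology; consequently ad⁰ of τ̄₃ (projective image A₅ ⊂
PGL₂(F₉)) has H⁰ = H¹ = 0 over 2·A₅ (inflation–restriction through the centre of order 2) and
τ̄₃(Γ_M(ζ₃)) is enormous (ACC+ Def 6.2.28); p = 5 fails (H¹(SL₂(F₅), Sym²) ≠ 0) and p = 2 is
pathological — 3 is the unique enormous Klein prime. [difficulty: provable-now] -/
@[route_item "route-Langlands-EvenIcosahedralCMCorner"]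
def DefectZeroA5 : Prop :=
  ∀ (k : Type) [Field k] [CharP k 3] (V : Rep k (alternatingGroup (Fin 5))), Module.finrank k V = 3 → V.ρ.IsIrreducible → Subsingleton (groupCohomology.H1 V) ∧ Subsingleton (groupCohomology.H2 V)

-- `DefectZeroA5` holds: proved by `Summit.Langlands.Langlands.Theorems.EvenIcosahedralCMCornerDefectZeroA5.defectZeroA5` (its module imports this route file, so no `_holds` link can be stated here).

/-- item stmt-Langlands-14441 · support · rank 9 · closed · proved by Summit.Langlands.Langlands.Theorems.EvenIcosahedralCMCornerSectorReduction.sectorReduction (prover) · by planner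
sources: BuzzardGeeLMS2014, Gelbart1997, Calegari2023
[support] glue to the target BY NAME: the 3-distinguished chain (door CMOrdinaryDoor → engine
ProAutomorphyAtKleinPrime → wall ArtinPointClassicalityCM → UntwistAutomorphy →
SolubleDescentMatching) together with the declared residual sub-sector NonDistinguishedComplement
yields X = EvenIcosahedralStrongArtin for every irreducible even icosahedral σ : Γ_ℚ → GL₂(ℂ): case
split on '3-distinguished at 3' (σ unramified at 3, charpoly X² − tX + d of Frob₃ with t² ≠ d, t² ≠
4d); an abstract ι : ℚ̄₃ ≃+* ℂ exists from Mathlib (IsAlgClosed.ringEquiv_of_equiv_of_charZero, both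
of cardinality 𝔠). Pure logic — the body of `closes` minus the junction; checked provable now
(planner Sketch.lean, lean rc 0, axioms propext/Classical.choice/Quot.sound). Filed so that an item
of the route concludes the target (gate stamp route.target-unreachable, D-0019/A11); `closes` stays
self-contained. [deps: CMOrdinaryDoor, ProAutomorphyAtKleinPrime, ArtinPointClassicalityCM,
UntwistAutomorphy, SolubleDescentMatching, NonDistinguishedComplement] [difficulty: provable-now] -/
@[route_item "route-Langlands-EvenIcosahedralCMCorner"]
def SectorReduction : Prop :=
  CMOrdinaryDoor → ProAutomorphyAtKleinPrime → ArtinPointClassicalityCM → UntwistAutomorphy → SolubleDescentMatching → NonDistinguishedComplement → EvenIcosahedralStrongArtin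

-- `SectorReduction` holds: proved by `Summit.Langlands.Langlands.Theorems.EvenIcosahedralCMCornerSectorReduction.sectorReduction` (its module imports this route file, so no `_holds` link can be stated here).

/-- item stmt-Langlands-2908 · support · rank 9 · open · by planner
sources: BuzzardGeeLMS2014, FontaineMazurGeometric1995
[support] X → Langlands: the rest of the summit (regular / totally-real–CM sectors, other n and F,
direction (A), and the upgrade of the a.e. `IsPiOfArtinRep` to `Corresponds` at every finite place
by local–global compatibility + strong multiplicity one). Not this route's business; filed so that
the Assembly ends in the summit constant; shared junction for every even-Artin card. [difficulty:
open-problem] -/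
@[route_item "route-Langlands-EvenIcosahedralCMCorner"]
def EvenArtinJunction : Prop :=
  (∀ ρ : Literature.NumberTheory.GaloisRepresentations.FramedGaloisRep ℚ ℂ 2, ρ.toGaloisRep.IsIrreducible → Nonempty ((Matrix.ProjGenLinGroup.mk.comp ρ.toMonoidHom).range ≃* alternatingGroup (Fin 5)) → (∀ (φ : ℚ →+* ℝ) (c : Field.absoluteGaloisGroup ℚ), Literature.NumberTheory.GaloisRepresentations.IsComplexConjugation φ c → Matrix.GeneralLinearGroup.det (ρ c) = 1) → ∃ (hcpt : Literature.NumberTheory.Automorphic.isCompact_glFiniteIntegralLevel 2 ℚ) (π : Literature.NumberTheory.Automorphic.CuspidalAutomorphicRepData 2 ℚ hcpt), (∀ᶠ v : IsDedekindDomain.HeightOneSpectrum (NumberField.RingOfIntegers ℚ) in Filter.cofinite, ∃ α : Multiset ℂ, π.1.HasSatakeParamAt v α ∧ ρ.IsUnramifiedAt v ∧ ρ.HasFrobCharpolyAt v (Literature.NumberTheory.Automorphic.satakePolynomial α))) → _root_.Langlands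

/-- item stmt-Langlands-14081 · assembly · rank 1 · closed · proved by Summit.Langlands.Langlands.Theorems.evenIcosahedralCMCorner_assembly_proof (prover) · by planner
sources: BuzzardGeeLMS2014, Gelbart1997
[assembly] CMOrdinaryDoor → ProAutomorphyAtKleinPrime → ArtinPointClassicalityCM → UntwistAutomorphy
→ SolubleDescentMatching → NonDistinguishedComplement → EvenArtinJunction → Langlands. -/
@[route_item "route-Langlands-EvenIcosahedralCMCorner"]
def Assembly : Prop :=
  CMOrdinaryDoor → ProAutomorphyAtKleinPrime → ArtinPointClassicalityCM → UntwistAutomorphy → SolubleDescentMatching → NonDistinguishedComplement → EvenArtinJunction → _root_.Langlands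

-- `Assembly` holds: proved by `Summit.Langlands.Langlands.Theorems.evenIcosahedralCMCorner_assembly_proof` (its module imports this route file, so no `_holds` link can be stated here).

/-! D-0027 §2.1 — DECIDING THEOREM (planner-authored via `route open/edit --closes-file`; by planner-plancard-Langlands-Langlands-even-ico-c7566e0e-g2-0 2026-08-15T19:23:06Z):
its hypotheses are this route's items and its conclusion the sub-problem Statement (glue_lint), and it elaborates with this file. -/

@[closes "route-Langlands-EvenIcosahedralCMCorner"] theorem closes (hD : CMOrdinaryDoor) (hE : ProAutomorphyAtKleinPrime) (hF : ArtinPointClassicalityCM)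
    (hG : UntwistAutomorphy) (hH : SolubleDescentMatching) (hC : NonDistinguishedComplement) (hJ : SectorJunction) :
    _root_.Langlands := by
  -- an abstract field isomorphism ι : ℚ̄₃ ≃+* ℂ (both algebraically closed, char 0, cardinality 𝔠)
  obtain ⟨ι⟩ : Nonempty (PadicAlgCl 3 ≃+* ℂ) := by
    have hQ : Cardinal.mk ℚ_[3] = Cardinal.continuum := by
      apply le_antisymm
      · have hsurj : Function.Surjective (Padic.mk : PadicSeq 3 → ℚ_[3]) :=
          fun x ↦ Quotient.inductionOn' x fun a ↦ ⟨a, rfl⟩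
        calc Cardinal.mk ℚ_[3] ≤ Cardinal.mk (PadicSeq 3) := Cardinal.mk_le_of_surjective hsurj
          _ ≤ Cardinal.mk (ℕ → ℚ) := Cardinal.mk_subtype_le _
          _ = Cardinal.continuum := by
            rw [Cardinal.mk_arrow, Cardinal.mk_eq_aleph0 ℚ, Cardinal.mk_eq_aleph0 ℕ]
            simp [Cardinal.aleph0_power_aleph0]
      · exact continuum_le_cardinal_of_nontriviallyNormedField ℚ_[3]
    have hC : Cardinal.mk (PadicAlgCl 3) = Cardinal.continuum := by
      apply le_antisymm
      · refine (Algebra.IsAlgebraic.cardinalMk_le_max ℚ_[3] (PadicAlgCl 3)).trans ?_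
        rw [hQ, max_eq_left Cardinal.aleph0_le_continuum]
      · rw [← hQ]
        exact Cardinal.mk_le_of_injective (algebraMap ℚ_[3] (PadicAlgCl 3)).injective
    refine IsAlgClosed.ringEquiv_of_equiv_of_charZero ?_ (Cardinal.eq.1 ?_)
    · rw [hC]; exact Cardinal.aleph0_lt_continuum
    · rw [hC, Cardinal.mk_complex]
  -- the junction reduces the summit to the even icosahedral strong Artin statement
  refine hJ fun σ hirr hico heven ↦ ?_
  by_cases h3 : ∀ v : IsDedekindDomain.HeightOneSpectrum (NumberField.RingOfIntegers ℚ), (3 : NumberField.RingOfIntegers ℚ) ∈ v.asIdeal → σ.IsUnramifiedAt v ∧ ∃ t d : ℂ, σ.HasFrobCharpolyAt v (Polynomial.X ^ 2 - Polynomial.C t * Polynomial.X + Polynomial.C d) ∧ t ^ 2 ≠ d ∧ t ^ 2 ≠ 4 * d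
  · -- the 3-distinguished sub-sector: door → engine → wall → untwist → descent
    obtain ⟨M, _, _, hCM, hGal, hSol, hζ, χ, τ, τ₃, htw, hav, hfin, hhyp⟩ := hD ι σ hirr hico heven h3
    obtain ⟨M', _, _, _, hCM', hGal', hSol', hfin', hico', 𝒰, hpa⟩ := hE ι M hCM hGal hSol hζ τ₃ hfin hhyp
    have hτ := hF ι M' hCM' (Literature.NumberTheory.GaloisRepresentations.FramedGaloisRep.restrictField M' τ)
      (Literature.NumberTheory.GaloisRepresentations.FramedGaloisRep.restrictField M' τ₃) (fun g ↦ hav _) hfin' hico' ⟨𝒰, hpa⟩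
    have hσ := hG M' (Literature.NumberTheory.GaloisRepresentations.FramedGaloisRep.restrictField M'
      (Literature.NumberTheory.GaloisRepresentations.FramedGaloisRep.restrictField M σ))
      (Literature.NumberTheory.GaloisRepresentations.FramedGaloisRep.restrictField M' τ)
      (Literature.NumberTheory.GaloisRepresentations.FramedGaloisRep.restrictField M' χ) (fun g ↦ htw _) hτ
    exact hH σ hirr hico M M' hGal' hSol' hσ
  · exact hC σ hirr hico heven h3

end Summit.Langlands.Langlands.Theses.EvenIcosahedralCMCorner
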